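import Summits.NavierStokesRegularity.FluidComputer.ClayBlowupLerayRate
import Literature.Analysis.FluidPDE.GigaMiura2011ScaledAlignmentTypeIHolds
import HarnessLib

/-!
# A TYPE-I unforced Clay blow-up has NO continuously aligned vorticity direction (Giga–Miura 2011 on
# the type)

Cell `ns-blowup`, seat `ns-blowup-ecbridge-2` (g8; the E–C endpoint theory seat). LABEL: E–C typing,
(A)-side (KERNEL — no named fact). WHAT THIS IS NOT: not Navier–Stokes evidence — a necessary condition on
the UNFORCED inhabitants of `ClayBlowup ν` / `DesignedBlowup ν` (the counterexamples to Fefferman's (A));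
no inhabitant is claimed. Companion memo: `run/shared/lean/pub/ns-blowup/ecbridge2/ECBRIDGE-2-MEMO-7.md`.

## Content

The tree PROVES Giga–Miura's theorem (`gigaMiura_continuousAlignment_typeI_holds`): a classical
unforced Leray–Hopf solution on `[0, T)`, bounded on closed sub-slabs, with a Type-I rate at `T` and a
CONTINUOUSLY ALIGNED vorticity direction on the high-vorticity regions (one modulus of continuity `η`,
one threshold `d`) extends past `T`. On the type (via the maximal Leray–Hopf completion
`ClayBlowup.exists_maximal_lerayHopf`, g8):

* **`ClayBlowup.not_continuousAlignment_of_typeI`** — if an unforced Clay blow-up is Type I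
  (`IsTypeIBlowup u T`), then for EVERY threshold `d > 0` and EVERY modulus `η` (monotone and
  continuous on `[0, ∞)`, `η 0 = 0`) the alignment `‖ξ(t,x) − ξ(t,y)‖ ≤ η(‖x − y‖)` FAILS at some
  `t ∈ (0, T)` and points `x, y` with `|ω(t,x)|, |ω(t,y)| > d`;
* `ClayBlowup.not_typeI_of_continuousAlignment` — contrapositive: a continuously aligned unforced
  Clay blow-up is Type II;
* the `DesignedBlowup` twins.

Compare `ClayBlowup.vorticityDirection_incoherent` (Constantin–Fefferman, g8: Lipschitz coherence of
`sin ∠(ξ(x), ξ(y))` fails, no rate hypothesis) — Giga–Miura trades the Lipschitz modulus for ANY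
modulus of continuity at the price of the Type-I hypothesis.

References: Y. Giga, H. Miura, Comm. Math. Phys. 303 (2011) [cite: GigaMiura2011, main theorem];
C. L. Fefferman, Clay problem description, (A) [cite: FeffermanClay2006, (A)].
-/

noncomputable section

namespace Summit.NavierStokesRegularity.FluidComputer

open Set MeasureTheory Filter Topology Function Metric
open scoped ENNReal ContDiff NNReal
open Literature.Analysis.FluidPDE
open Summit.NavierStokesRegularity.NavierStokesRegularity

namespace ClayBlowup

variable {ν : ℝ} (X : ClayBlowup ν)

/-- **GIGA–MIURA ON THE TYPE: a Type-I unforced Clay blow-up is never continuously aligned**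
(`ν > 0`, `f = 0`; no named fact). If `IsTypeIBlowup u T`, then for every `d > 0` and every modulus
`η` (monotone and continuous on `[0, ∞)`, `η 0 = 0`) there are `t ∈ (0, T)` and `x, y` with
`|curl u(t, x)| > d`, `|curl u(t, y)| > d` and `‖ξ(t,x) − ξ(t,y)‖ > η(‖x − y‖)`,
`ξ = vorticityDirection (curl (u t))`. The tree theorem `gigaMiura_continuousAlignment_typeI_holds`
on the maximal Leray–Hopf completion (`exists_maximal_lerayHopf`), whose slices before `T` are those of
`u` (so boundedness on sub-slabs, the Type-I rate and the alignment transfer).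
[cite: GigaMiura2011, main theorem] -/
theorem not_continuousAlignment_of_typeI (hν : 0 < ν) (hf : X.f = 0) (hI : IsTypeIBlowup X.u X.T)
    {d : ℝ} (hd : 0 < d) {η : ℝ → ℝ} (hηm : MonotoneOn η (Ici 0)) (hηc : ContinuousOn η (Ici 0))
    (hη0 : η 0 = 0) :
    ∃ t ∈ Ioo 0 X.T, ∃ x y : EuclideanSpace ℝ (Fin 3),
      d < ‖curl (X.u t) x‖ ∧ d < ‖curl (X.u t) y‖ ∧
        η ‖x - y‖ <
          ‖vorticityDirection (curl (X.u t)) x - vorticityDirection (curl (X.u t)) y‖ := by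
  have hT := X.T_pos
  by_contra hcon
  push Not at hcon
  obtain ⟨v, hvu, hmax, hLH⟩ := X.exists_maximal_lerayHopf hν hf
  -- boundedness on closed sub-slabs transfers to `v`
  have hbdd : ∀ T' < X.T, ∃ M : ℝ, ∀ t ∈ Icc 0 T', ∀ x, ‖v t x‖ ≤ M := by
    intro T' hT'
    obtain ⟨B, hB⟩ := X.exists_norm_le hν hT'
    exact ⟨B, fun t ht x => by rw [hvu t ⟨ht.1, ht.2.trans_lt hT'⟩]; exact hB t ht x⟩
  -- the Type-I rate transfers to `v`
  have hIv : IsTypeIBlowup v X.T := by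
    obtain ⟨C, hC⟩ := hI
    refine ⟨C, ?_⟩
    filter_upwards [hC, Ico_mem_nhdsLT hT] with t ht htI
    rw [hvu t htI]
    exact ht
  -- the alignment transfers to `v`
  have hCA : ∃ d' : ℝ, 0 < d' ∧ ∃ η' : ℝ → ℝ, MonotoneOn η' (Ici 0) ∧ ContinuousOn η' (Ici 0) ∧
      η' 0 = 0 ∧ ∀ t ∈ Ioo 0 X.T, ∀ x y : EuclideanSpace ℝ (Fin 3),
        d' < ‖curl (v t) x‖ → d' < ‖curl (v t) y‖ →
          ‖vorticityDirection (curl (v t)) x - vorticityDirection (curl (v t)) y‖ ≤ η' ‖x - y‖ := by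
    refine ⟨d, hd, η, hηm, hηc, hη0, fun t ht x y hx hy => ?_⟩
    rw [hvu t ⟨ht.1.le, ht.2⟩] at hx hy ⊢
    exact hcon t ht x y hx hy
  exact hmax.2 (gigaMiura_continuousAlignment_typeI_holds hν hT hmax.1 hLH hbdd hIv hCA)

/-- **Contrapositive: a continuously aligned unforced Clay blow-up is TYPE II** (`ν > 0`, `f = 0`;
no named fact): if for some `d > 0` and some modulus `η` the vorticity direction satisfies
`‖ξ(t,x) − ξ(t,y)‖ ≤ η(‖x − y‖)` on `{|ω(t,·)| > d}` for all `t ∈ (0, T)`, then `¬ IsTypeIBlowup u T`.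
[cite: GigaMiura2011, main theorem] -/
theorem not_typeI_of_continuousAlignment (hν : 0 < ν) (hf : X.f = 0) {d : ℝ} (hd : 0 < d)
    {η : ℝ → ℝ} (hηm : MonotoneOn η (Ici 0)) (hηc : ContinuousOn η (Ici 0)) (hη0 : η 0 = 0)
    (hCA : ∀ t ∈ Ioo 0 X.T, ∀ x y : EuclideanSpace ℝ (Fin 3),
      d < ‖curl (X.u t) x‖ → d < ‖curl (X.u t) y‖ →
        ‖vorticityDirection (curl (X.u t)) x - vorticityDirection (curl (X.u t)) y‖ ≤ η ‖x - y‖) :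
    ¬ IsTypeIBlowup X.u X.T := by
  intro hI
  obtain ⟨t, ht, x, y, hx, hy, hlt⟩ := X.not_continuousAlignment_of_typeI hν hf hI hd hηm hηc hη0
  exact (not_le.2 hlt) (hCA t ht x y hx hy)

end ClayBlowup

namespace DesignedBlowup

variable {ν : ℝ} (D : DesignedBlowup ν)

/-- **Giga–Miura for an unforced designed blow-up**: Type I ⇒ no continuous alignment.
[cite: GigaMiura2011, main theorem] -/
theorem not_continuousAlignment_of_typeI (hν : 0 < ν) (hf : D.f = 0) (hI : IsTypeIBlowup D.u D.T)
    {d : ℝ} (hd : 0 < d) {η : ℝ → ℝ} (hηm : MonotoneOn η (Ici 0)) (hηc : ContinuousOn η (Ici 0))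
    (hη0 : η 0 = 0) :
    ∃ t ∈ Ioo 0 D.T, ∃ x y : EuclideanSpace ℝ (Fin 3),
      d < ‖curl (D.u t) x‖ ∧ d < ‖curl (D.u t) y‖ ∧
        η ‖x - y‖ <
          ‖vorticityDirection (curl (D.u t)) x - vorticityDirection (curl (D.u t)) y‖ :=
  D.toClayBlowup.not_continuousAlignment_of_typeI hν hf hI hd hηm hηc hη0

/-- **A continuously aligned unforced designed blow-up is Type II.** [cite: GigaMiura2011, main theorem] -/
theorem not_typeI_of_continuousAlignment (hν : 0 < ν) (hf : D.f = 0) {d : ℝ} (hd : 0 < d)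
    {η : ℝ → ℝ} (hηm : MonotoneOn η (Ici 0)) (hηc : ContinuousOn η (Ici 0)) (hη0 : η 0 = 0)
    (hCA : ∀ t ∈ Ioo 0 D.T, ∀ x y : EuclideanSpace ℝ (Fin 3),
      d < ‖curl (D.u t) x‖ → d < ‖curl (D.u t) y‖ →
        ‖vorticityDirection (curl (D.u t)) x - vorticityDirection (curl (D.u t)) y‖ ≤ η ‖x - y‖) :
    ¬ IsTypeIBlowup D.u D.T :=
  D.toClayBlowup.not_typeI_of_continuousAlignment hν hf hd hηm hηc hη0 hCA

end DesignedBlowup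

end Summit.NavierStokesRegularity.FluidComputer

end
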